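import Summits.CriticalPhenomena.PercolationContinuityZ3.Theorems.Transplant.FKConnectivityAllQAntipodalGadget
import HarnessLib

/-!
# Connectivity correlation inequalities for `φ_{w,q}`, every `q > 0` — file 42b: the gadget identity for the LIVE edge

Support file (`--supports stmt-CriticalPhenomena-4575`), FK sub-lane `prim-bschramm-fk-2` (gen 20); builds on p205010 (kernel theorem,
internal audit signed; external expert review pending).  No definitions, no named facts, no sorries; standard axioms.

Companion of file 42a (`FK.gadget_contract_eq`, `FK.gadget_delete_eq`): **`FK.gadget_live_eq`** —
`q² · apPsiC q (M ∪ {uv, um, mv}) C f g = (2 + q) · apPsiC q (M ∪ {uv}) C f g + 2q · apPsiC q M (C ∪ {uv}) f g`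
for `m` isolated from `M ∪ C`, `m ≠ u, v`, `u ≠ v`, `uv ∉ M`, `f, g` not reading `uv, um, mv` (eight states of `(uv, um, mv)` per complementary pair;
memo `bschramm/FROM-fk-2-g20-LEVEL3-ONESUM.md` §6.2).
[cite: Grimmett2006, §1.4 eq. (1.20) (p. 15); §3.8 (pp. 61–62)]
-/

noncomputable section

namespace Summit.CriticalPhenomena.PercolationContinuityZ3.Theorems

namespace FK

open Literature.Probability.LatticeModels Literature.Probability.Percolation
open scoped Classical

variable {V : Type*} [Fintype V] {u v m : V} {M C : Finset (Sym2 V)} {q : ℝ} {f g : Finset (Sym2 V) → ℝ}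

/-- **GADGET, LIVE EDGE**: `q² · apPsiC q (M ∪ {uv, um, mv}) C f g = (2 + q) · apPsiC q (M ∪ {uv}) C f g + 2q · apPsiC q M (C ∪ {uv}) f g`
(same hypotheses). [cite: Grimmett2006, §1.4 eq. (1.20) (p. 15)] -/
theorem gadget_live_eq (huv : u ≠ v) (hum : u ≠ m) (hvm : v ≠ m)
    (hmM : ∀ e ∈ M, m ∉ e) (hmC : ∀ e ∈ C, m ∉ e) (heM : s(u, v) ∉ M)
    (hfe : ∀ A : Finset (Sym2 V), f (insert s(u, v) A) = f A)
    (hfa : ∀ A : Finset (Sym2 V), f (insert s(u, m) A) = f A) (hfb : ∀ A : Finset (Sym2 V), f (insert s(m, v) A) = f A)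
    (hge : ∀ A : Finset (Sym2 V), g (insert s(u, v) A) = g A)
    (hga : ∀ A : Finset (Sym2 V), g (insert s(u, m) A) = g A) (hgb : ∀ A : Finset (Sym2 V), g (insert s(m, v) A) = g A) :
    q ^ 2 * apPsiC q (insert s(u, v) (insert s(u, m) (insert s(m, v) M))) C f g =
      (2 + q) * apPsiC q (insert s(u, v) M) C f g + 2 * q * apPsiC q M (insert s(u, v) C) f g := by
  set a := s(u, m) with ha
  set b := s(m, v) with hb
  set e := s(u, v) with he
  have hab : a ≠ b := by
    intro h; rw [ha, hb, Sym2.eq_iff] at h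
    rcases h with ⟨h1, _⟩ | ⟨h1, _⟩
    · exact hum h1
    · exact huv h1
  have hea : e ≠ a := by
    intro h; rw [he, ha, Sym2.eq_iff] at h
    rcases h with ⟨_, h2⟩ | ⟨h1, _⟩
    · exact hvm h2
    · exact hum h1
  have heb : e ≠ b := by
    intro h; rw [he, hb, Sym2.eq_iff] at h
    rcases h with ⟨h1, _⟩ | ⟨_, h2⟩
    · exact hum h1
    · exact hvm h2
  have haM : a ∉ M := fun h => hmM a h (Sym2.mem_mk_right _ _)
  have hbM : b ∉ M := fun h => hmM b h (Sym2.mem_mk_left _ _)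
  have heM' : e ∉ insert a (insert b M) := by
    rw [Finset.mem_insert, Finset.mem_insert, not_or, not_or]; exact ⟨hea, heb, heM⟩
  have hme : m ∉ e := fun hm => by
    rcases Sym2.mem_iff.1 hm with h | h
    · exact hum h.symm
    · exact hvm h.symm
  have iso : ∀ γ : Finset (Sym2 V), γ ⊆ M → ∀ e' ∈ γ ∪ C, m ∉ e' := by
    intro γ hγ e' he'
    rcases Finset.mem_union.1 he' with h | h
    · exact hmM e' (hγ h)
    · exact hmC e' h
  have isoe : ∀ γ : Finset (Sym2 V), γ ⊆ M → ∀ e' ∈ insert e (γ ∪ C), m ∉ e' := by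
    intro γ hγ e' he'
    rcases Finset.mem_insert.1 he' with rfl | h
    · exact hme
    · exact iso γ hγ e' h
  have reach : ∀ X : Finset (Sym2 V), (openGraph (↑(insert e X) : BondConfig V)).Reachable u v := fun X =>
    reachable_of_mem_edge huv (Finset.mem_insert_self _ _)
  unfold apPsiC
  have haM' : a ∉ insert b M := by rw [Finset.mem_insert, not_or]; exact ⟨hab, haM⟩
  rw [Finset.sum_powerset_insert heM', Finset.sum_powerset_insert haM', Finset.sum_powerset_insert haM',
    Finset.sum_powerset_insert hbM, Finset.sum_powerset_insert hbM, Finset.sum_powerset_insert hbM, Finset.sum_powerset_insert hbM,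
    Finset.sum_powerset_insert heM]
  simp only [← Finset.sum_add_distrib, Finset.mul_sum]
  refine Finset.sum_congr rfl fun γ hγ => ?_
  rw [Finset.mem_powerset] at hγ
  obtain ⟨s1, s2, s3, s4⟩ := sdiff_gadget hab haM hbM hγ
  have hγc : M \ γ ⊆ M := Finset.sdiff_subset
  have heγ : e ∉ γ := fun h => heM (hγ h)
  -- complements in the live set with e
  have c0 : ∀ γ' : Finset (Sym2 V), γ' ⊆ insert a (insert b M) →
      insert e (insert a (insert b M)) \ γ' = insert e (insert a (insert b M) \ γ') := fun γ' hγ' =>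
    Finset.insert_sdiff_of_notMem _ (fun h => heM' (hγ' h))
  have c1 : ∀ γ' : Finset (Sym2 V), insert e (insert a (insert b M)) \ insert e γ' = insert a (insert b M) \ γ' := fun γ' => by
    rw [Finset.insert_sdiff_insert, Finset.sdiff_insert_of_notMem heM']
  have gγ : γ ⊆ insert a (insert b M) := hγ.trans ((Finset.subset_insert _ _).trans (Finset.subset_insert _ _))
  have gb : insert b γ ⊆ insert a (insert b M) := (Finset.insert_subset_insert _ hγ).trans (Finset.subset_insert _ _)
  have ga : insert a γ ⊆ insert a (insert b M) := Finset.insert_subset_insert _ (hγ.trans (Finset.subset_insert _ _))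
  have gab : insert a (insert b γ) ⊆ insert a (insert b M) := Finset.insert_subset_insert _ (Finset.insert_subset_insert _ hγ)
  have t1 : insert e M \ γ = insert e (M \ γ) := Finset.insert_sdiff_of_notMem _ heγ
  have t2 : insert e M \ insert e γ = M \ γ := by rw [Finset.insert_sdiff_insert, Finset.sdiff_insert_of_notMem heM]
  unfold apExpC
  rw [c0 _ gγ, c0 _ gb, c0 _ ga, c0 _ gab, c1, c1, c1, c1, s1, s2, s3, s4, t1, t2]
  simp only [Finset.insert_union, Finset.union_insert, hfa, hfb, hga, hgb, hfe, hge]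
  -- cluster counts: bases R1 = γ ∪ C, R2 = (M∖γ) ∪ C, X1 = insert e R1, X2 = insert e R2
  set R1 := clusterCount (↑(γ ∪ C) : BondConfig V) ∅ with hR1
  set R2 := clusterCount (↑((M \ γ) ∪ C) : BondConfig V) ∅ with hR2
  set X1 := clusterCount (↑(insert e (γ ∪ C)) : BondConfig V) ∅ with hX1
  set X2 := clusterCount (↑(insert e ((M \ γ) ∪ C)) : BondConfig V) ∅ with hX2
  set F := (f (γ ∪ C) - f ((M \ γ) ∪ C)) * (g (γ ∪ C) - g ((M \ γ) ∪ C)) with hF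
  have kx1 := clusterCount_insert_add_ite (γ ∪ C) u v
  rw [← he] at kx1
  have kx2 := clusterCount_insert_add_ite ((M \ γ) ∪ C) u v
  rw [← he] at kx2
  -- gadget on X1 (u ~ v), e written outermost
  have a11 : clusterCount (↑(insert e (insert a (γ ∪ C))) : BondConfig V) ∅ + 1 = X1 := by
    rw [Finset.insert_comm, ha, Sym2.eq_swap]; exact clusterCount_insert_pendant (isoe γ hγ) hum.symm
  have b11 : clusterCount (↑(insert e (insert b (γ ∪ C))) : BondConfig V) ∅ + 1 = X1 := by
    rw [Finset.insert_comm]; exact clusterCount_insert_pendant (isoe γ hγ) hvm.symm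
  have ab11 := clusterCount_insert_path2 (isoe γ hγ) hum hvm (X := insert e (γ ∪ C))
  rw [if_pos (reach _), add_zero, ← ha, ← hb, Finset.insert_comm b e, Finset.insert_comm a e] at ab11
  -- gadget on R2
  have a02 : clusterCount (↑(insert a ((M \ γ) ∪ C)) : BondConfig V) ∅ + 1 = R2 := by
    rw [ha, Sym2.eq_swap]; exact clusterCount_insert_pendant (iso (M \ γ) hγc) hum.symm
  have b02 : clusterCount (↑(insert b ((M \ γ) ∪ C)) : BondConfig V) ∅ + 1 = R2 :=
    clusterCount_insert_pendant (iso (M \ γ) hγc) hvm.symm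
  have ab02 := clusterCount_insert_path2 (iso (M \ γ) hγc) hum hvm (X := (M \ γ) ∪ C)
  rw [← ha, ← hb] at ab02
  -- gadget on R1
  have a01 : clusterCount (↑(insert a (γ ∪ C)) : BondConfig V) ∅ + 1 = R1 := by
    rw [ha, Sym2.eq_swap]; exact clusterCount_insert_pendant (iso γ hγ) hum.symm
  have b01 : clusterCount (↑(insert b (γ ∪ C)) : BondConfig V) ∅ + 1 = R1 := clusterCount_insert_pendant (iso γ hγ) hvm.symm
  have ab01 := clusterCount_insert_path2 (iso γ hγ) hum hvm (X := γ ∪ C)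
  rw [← ha, ← hb] at ab01
  -- gadget on X2 (u ~ v), e written outermost
  have a12 : clusterCount (↑(insert e (insert a ((M \ γ) ∪ C))) : BondConfig V) ∅ + 1 = X2 := by
    rw [Finset.insert_comm, ha, Sym2.eq_swap]; exact clusterCount_insert_pendant (isoe (M \ γ) hγc) hum.symm
  have b12 : clusterCount (↑(insert e (insert b ((M \ γ) ∪ C))) : BondConfig V) ∅ + 1 = X2 := by
    rw [Finset.insert_comm]; exact clusterCount_insert_pendant (isoe (M \ γ) hγc) hvm.symm
  have ab12 := clusterCount_insert_path2 (isoe (M \ γ) hγc) hum hvm (X := insert e ((M \ γ) ∪ C))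
  rw [if_pos (reach _), add_zero, ← ha, ← hb, Finset.insert_comm b e, Finset.insert_comm a e] at ab12
  -- the eight states (ε = 1: replica 1 on X1, replica 2 on R2; ε = 0: replica 1 on R1, replica 2 on X2)
  have p1_00 := pow_gadget1 (q := q) (E := X1 + R2)
    (n := X1 + clusterCount (↑(insert a (insert b ((M \ γ) ∪ C))) : BondConfig V) ∅)
    (P := (openGraph (↑((M \ γ) ∪ C) : BondConfig V)).Reachable u v) (by split_ifs at ab02 ⊢ <;> omega)
  have p1_0b := pow_gadget2 (q := q) (E := X1 + R2)
    (n := clusterCount (↑(insert e (insert b (γ ∪ C))) : BondConfig V) ∅ + clusterCount (↑(insert a ((M \ γ) ∪ C)) : BondConfig V) ∅)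
    (by omega)
  have p1_a0 := pow_gadget2 (q := q) (E := X1 + R2)
    (n := clusterCount (↑(insert e (insert a (γ ∪ C))) : BondConfig V) ∅ + clusterCount (↑(insert b ((M \ γ) ∪ C)) : BondConfig V) ∅)
    (by omega)
  have p1_ab : q ^ 2 * q ^ (clusterCount (↑(insert e (insert a (insert b (γ ∪ C)))) : BondConfig V) ∅ + R2) = q * q ^ (X1 + R2) := by
    rw [show X1 + R2 = (clusterCount (↑(insert e (insert a (insert b (γ ∪ C)))) : BondConfig V) ∅ + R2) + 1 by omega]; ring
  have p0_00 : q ^ 2 * q ^ (R1 + clusterCount (↑(insert e (insert a (insert b ((M \ γ) ∪ C)))) : BondConfig V) ∅) =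
      q * q ^ (R1 + X2) := by
    rw [show R1 + X2 = (R1 + clusterCount (↑(insert e (insert a (insert b ((M \ γ) ∪ C)))) : BondConfig V) ∅) + 1 by omega]; ring
  have p0_0b := pow_gadget2 (q := q) (E := R1 + X2)
    (n := clusterCount (↑(insert b (γ ∪ C)) : BondConfig V) ∅ + clusterCount (↑(insert e (insert a ((M \ γ) ∪ C))) : BondConfig V) ∅)
    (by omega)
  have p0_a0 := pow_gadget2 (q := q) (E := R1 + X2)
    (n := clusterCount (↑(insert a (γ ∪ C)) : BondConfig V) ∅ + clusterCount (↑(insert e (insert b ((M \ γ) ∪ C))) : BondConfig V) ∅)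
    (by omega)
  have p0_ab := pow_gadget1 (q := q) (E := R1 + X2)
    (n := clusterCount (↑(insert a (insert b (γ ∪ C))) : BondConfig V) ∅ + X2)
    (P := (openGraph (↑(γ ∪ C) : BondConfig V)).Reachable u v) (by split_ifs at ab01 ⊢ <;> omega)
  -- the K-term
  have pK1 := pow_gadgetT (q := q) (E := X1 + R2) (n := X1 + X2)
    (P := (openGraph (↑((M \ γ) ∪ C) : BondConfig V)).Reachable u v) (by split_ifs at kx2 ⊢ <;> omega)
  have pK2 := pow_gadgetT (q := q) (E := R1 + X2) (n := X1 + X2)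
    (P := (openGraph (↑(γ ∪ C) : BondConfig V)).Reachable u v) (by split_ifs at kx1 ⊢ <;> omega)
  linear_combination F * p1_00 + F * p1_0b + F * p1_a0 + F * p1_ab + F * p0_00 + F * p0_0b + F * p0_a0 + F * p0_ab -
    F * pK1 - F * pK2

end FK

end Summit.CriticalPhenomena.PercolationContinuityZ3.Theorems

end
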